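import Literature.NumberTheory.EllipticCurves.HeegnerPointsKolyvaginPairing
import Summits.BirchSwinnertonDyer.BirchSwinnertonDyer.Theorems.GenusKolyvaginAtTwoOffCutResidualAtTwoRLw2PhantomExclusionWitness
import Summits.BirchSwinnertonDyer.BirchSwinnertonDyer.Theses.GenusKolyvaginAtTwo
import HarnessLib

/-!
**g27 pen revision (2026-08-30): stubs `stub_transport` and `stub_KLW` DISCHARGED BY NAME (gk2-p4 g31: `Lw2PhantomExclusion.levelTwoWitness_baseChange_of_rat`,
`Lw2PhantomExclusion.nonPhantom_baseChange_of_levelTwoWitness`, both VERBATIM; import `…Lw2PhantomExclusionWitness`); remaining stubs: `stub_Q3flat`, `stub_Q4flat` (flat re-threads —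
gk2-p4's `…Lw2Flat*` modules are the landed pieces) and the declared residual `stub_residual`; composition unchanged.  No summit is proved by a line.**

# LINE 26 «lw2_phantom_exclusion» — skeleton for the residual crux `OffCutResidualAtTwoR` (stmt-BirchSwinnertonDyer-31767)

bsd-idea-1 g24 (D-0145 ideator seat; technique card «compactness–contradiction / rigidity»).  Route
`route-BirchSwinnertonDyer-GenusKolyvaginAtTwo` rev 57, rung K4 `Rank1Residual.NonCMAtTwo`.

THE LEVER (new object on this route: the Lawson–Wuthrich class at level 2).  The odd-multiplicative CUT of the main engine
exists only to feed `(NPh)` — «no non-zero PHANTOM class of `H¹(K, E[2^M])` (one dying on `Γ_{K(E[2^M])}`) is Kummer at the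
places over `2N`» (LINE 18 stub `stub_nonPhantomAtTwo`, discharged on the cut by the Tate transvection at an odd multiplicative
place, `NonPhantomPow.nonPhantomAtTwo_of_hasMultiplicativeReductionAt`).  The phantom group is `H¹(GL₂(ℤ/2^M), (ℤ/2^M)²) = ℤ/2`
and — the point of this line — its image under `×2^(M-1)` is the level-2 class `ξ ∈ H¹(K, E[2])` inflated from
`H¹(GL₂(ℤ/2^M), E[2]) = Hom_(S₃)(U^ab ⊗ 𝔽₂, St) = ℤ/2` (U = the level-2 congruence kernel, St = E[2]; `H^i(S₃, St) = 0`, St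
projective over 𝔽₂[S₃]), for EVERY `M ≥ 2`.  Kummer maps commute with `×2` and `ker(H¹(E[2^(j-1)]) → H¹(E[2^j]))` is the Kummer
image of `E(K_w)[2]`, so by downward induction on the level:  **if `ξ` is NOT in the local Kummer image at ONE place `w₀ ∣ 2N`,
then `(NPh_M)` holds at every level `M ≥ 1`** (`klw_byName`).  `ξ` has the explicit Kummer representative `α = −Δ·F′(e) ∈ L^×/L^×²`
(`L = ℚ(e)` the cubic 2-division field; `N(α) = 16^k Δ⁴`), so «`ξ` not Kummer at `v`» is a per-curve DECIDABLE 2-descent local-image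
test — instrument `LW2` (kit j339743/j339762): of the 58 cells of the first slice of `OffCutResidualAtTwoR` (habitat, no odd
multiplicative prime, `#Sel₂(E) ≠ 1`, `N < 5·10⁵`), **24 have a witness, all at `v = 2 ∣ N`** (17/17 multiplicative at 2 — where
the naive port of the cut is a PHANTOM (V2-PHANTOM memo: `θ|⟨u²⟩ = 0`) — and 7/23 additive at 2; 0/18 good at 2); CONTROL: on cut
cells the witness is exactly the odd multiplicative prime (4/4, as the theory predicts).  Odd additive primes never witness
(`α` is locally trivial there: `C₃ ◁ D_v` resp. `I₀*`).

STUBS (5): `transport_byName` (ℚ_v = K_w plumbing for `v ∣ N` split in the Heegner field), `klw_byName` (the lever, pure Galois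
cohomology, all levels), `stub_Q3flat` / `stub_Q4flat` (the LANDED exactness theorems `EquivariantKolyvaginExactAtTwoRT` /
`KolyvaginExactAtTwoPosDiscT` with their three `v`-binders replaced by the hypothesis `(NPh at 2N)(W, K)` (inline) — their proofs consume `v`
only through `nonPhantomAtTwo_of_hasMultiplicativeReductionAt`, in `…SelmerLayerOneAtTwo`, `…ShaFiniteAtTwo`,
`…PosTBottomRungSocketTransposition`, `…PosTE4PosOfSockets`, `…SharpExponentRat…`), `stub_residual` (the new residual: slice 1
shrinks to `… ∧ ¬ LW₂(W)`, 58 → 34 cells below `5·10⁵`).  Composition `OffCutResidualAtTwoR_of` = `closes` (rev 57) cut branches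
with `(v, h2v, hNv, hmv)` replaced by `(w₀, LW₂At)` ↦ `(NPh at 2N)`.  No summit is proved by this line.
-/

open scoped Classical NumberField

namespace Summit.BirchSwinnertonDyer.BirchSwinnertonDyer.Cruxes.OffCutResidualAtTwoR.Lw2PhantomExclusion

open WeierstrassCurve NumberField IsDedekindDomain Literature.NumberTheory.EllipticCurves
  Literature.NumberTheory.EllipticCurves.ModularForms
open Summit.BirchSwinnertonDyer.BirchSwinnertonDyer.Theses.GenusKolyvaginAtTwo

/-!  The three PREDICATE SHAPES of this line are written INLINE (a Lines workfile may not define propositions under `Summits/`):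
* `(NPh at 2N)(W, K)` := `∀ M ≥ 1, ∀ z ∈ H¹(K, E[2^M]), ([z, ρ] = 0 on Γ_(K(E[2^M]))) → (z Kummer at every w ∣ 2N) → z = 0` — VERBATIM the
  conclusion of LINE 18's registered stub `stub_nonPhantomAtTwo` (`NonPhantomPow.nonPhantomAtTwo_of_hasMultiplicativeReductionAt`);
* `LW₂At(W', w₀)` := `∀ z ∈ H¹(F, E[2]), z ≠ 0 → ([z, ρ] = 0 on Γ_(F(E[4]))) → z ∉ (local Kummer kernel at w₀)` — for surjective `ρ̄_(E,4)` the
  only candidate `z` is the Lawson–Wuthrich class `ξ = [−Δ·F′(e)]`; decidable per curve (2-descent local image);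
* `LW₂(W)` := `∃ v ∣ N, LW₂At(W, v)` over `ℚ` (a witness prime dividing `N`, hence split in every Heegner field of the frame).
[cite: LawsonWuthrich2016, §4, §7.1 and §8] [cite: GrossLMS1991, §9] -/

/-- **g27 pen (2026-08-30): THIS STUB IS A TREE THEOREM — `GenusExact.Lw2PhantomExclusion.levelTwoWitness_baseChange_of_rat` (p781093 (module …Lw2PhantomExclusionWitness), gk2-p4 g31) has the statement VERBATIM; the decl is renamed `transport_byName`
and PROVED by that name (no `sorry`).  Original stub text follows.**

STUB (plumbing, S/M): transport of the witness from `ℚ_v` to `K_w`, `w ∣ v`, for `v ∣ N` split in the Heegner field `K`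
(`e = f = 1`: `ramificationIdx_eq_one_and_inertiaDeg_eq_one_of_natCast_mem_of_satisfiesHeegnerHypothesis`), and `res ξ_ℚ = ξ_K`
is again the unique non-zero phantom class over `K` (the 2-adic image over `K` is still full under the frame's two `¬ IsSquare`
clauses: `…GenusPrimitiveSupplyAtTwoTwoAdicImageOverKH1`).  Why plausible: restriction along `K_w = ℚ_v` identifies the local
Kummer kernels.  [folklore; Silverman AEC X.4] -/
theorem transport_byName :
    ∀ (W : WeierstrassCurve ℚ) [W.IsElliptic] [W.IsGloballyMinimal] [NeZero (W.conductorNorm ℤ)],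
      Odd W.tamagawaProduct → (∀ n : ℕ, 0 < n → W.HasSurjectiveModNGaloisRep ((2 : ℤ) ^ n)) →
      ∀ (K : Type) [Field K] [NumberField K], IsImaginaryQuadratic K → Odd (NumberField.discr K) →
        SatisfiesHeegnerHypothesis (W.conductorNorm ℤ) K →
        ¬ IsSquare ((NumberField.discr K : ℚ) * -|W.Δ|) → ¬ IsSquare ((NumberField.discr K : ℚ) * (-(2 * |W.Δ|))) →
        (∃ v : HeightOneSpectrum (𝓞 ℚ), ((W.conductorNorm ℤ : ℕ) : 𝓞 ℚ) ∈ v.asIdeal ∧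
          (∀ z : galH1Torsion W 2, z ≠ 0 → (∀ ρ ∈ torsionFixing W 4, h1Eval W 2 z ρ = 0) →
            z ∉ selmerLocalKer W (v.adicCompletion ℚ) 2)) →
        ∃ w₀ : HeightOneSpectrum (𝓞 K), ((2 * W.conductorNorm ℤ : ℕ) : 𝓞 K) ∈ w₀.asIdeal ∧
          (∀ z : galH1Torsion (W.baseChange K) 2, z ≠ 0 → (∀ ρ ∈ torsionFixing (W.baseChange K) 4, h1Eval (W.baseChange K) 2 z ρ = 0) →
            z ∉ selmerLocalKer (W.baseChange K) (w₀.adicCompletion K) 2) :=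
  -- g27 pen: DISCHARGED BY NAME — gk2-p4 g31's tree theorem, statement VERBATIM (p781093 (module …Lw2PhantomExclusionWitness))
  Summit.BirchSwinnertonDyer.BirchSwinnertonDyer.Theorems.GenusExact.Lw2PhantomExclusion.levelTwoWitness_baseChange_of_rat

/-- **g27 pen (2026-08-30): THIS STUB IS A TREE THEOREM — `GenusExact.Lw2PhantomExclusion.nonPhantom_baseChange_of_levelTwoWitness` (p780467 (module …Lw2PhantomExclusionKLW), gk2-p4 g31) has the statement VERBATIM; the decl is renamed `klw_byName`
and PROVED by that name (no `sorry`).  Original stub text follows.**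

STUB (THE LEVER, M): **phantom exclusion from a level-2 witness, every level.**  If the Lawson–Wuthrich class is not Kummer
at one place `w₀` over `2N`, then no non-zero phantom class of `H¹(K, E[2^M])` is Kummer at all places over `2N`, for every
`M ≥ 1`.  Proof plan: (i) `H¹(Gal(K(E[2^M])/K), E[2]) = ℤ/2`, generated by inflation from level 4 (inflation–restriction with the
level-2 congruence kernel `U`, `H^i(S₃, St) = 0`, `Hom_(S₃)(U/Φ(U), St) = 𝔽₂` since `U/Φ(U) = M₂(𝔽₂)` resp. an extension of it by a
trivial `𝔽₂` for `M ≥ 3`); (ii) `(×2^(M−1))_*` of a phantom class is phantom, of a Kummer class is Kummer; (iii) `ker(H¹(E[2^(j−1)]) →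
H¹(E[2^j])) = δ(E(K_w)[2]) ⊆ im δ` locally and `= 0` globally (`E(K)[2] = 0`), so a phantom Kummer-at-`w₀` class with trivial
`(×2^(M−1))_*`-image descends one level; induct.  Why it might fail: only through (i) over `K` (index-2 image) — guarded by the
frame's `¬ IsSquare` clauses.  [cite: LawsonWuthrich2016, §4 and §8] -/
theorem klw_byName :
    ∀ (W : WeierstrassCurve ℚ) [W.IsElliptic] [W.IsGloballyMinimal] [NeZero (W.conductorNorm ℤ)],
      Odd W.tamagawaProduct → (∀ n : ℕ, 0 < n → W.HasSurjectiveModNGaloisRep ((2 : ℤ) ^ n)) →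
      ∀ (K : Type) [Field K] [NumberField K], IsImaginaryQuadratic K → Odd (NumberField.discr K) →
        SatisfiesHeegnerHypothesis (W.conductorNorm ℤ) K →
        ¬ IsSquare ((NumberField.discr K : ℚ) * -|W.Δ|) → ¬ IsSquare ((NumberField.discr K : ℚ) * (-(2 * |W.Δ|))) →
        ∀ w₀ : HeightOneSpectrum (𝓞 K), ((2 * W.conductorNorm ℤ : ℕ) : 𝓞 K) ∈ w₀.asIdeal →
          (∀ z : galH1Torsion (W.baseChange K) 2, z ≠ 0 → (∀ ρ ∈ torsionFixing (W.baseChange K) 4, h1Eval (W.baseChange K) 2 z ρ = 0) →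
            z ∉ selmerLocalKer (W.baseChange K) (w₀.adicCompletion K) 2) →
        (∀ (Mlev : ℕ), 1 ≤ Mlev → ∀ z : galH1Torsion (W.baseChange K) ((2 ^ Mlev : ℕ) : ℤ),
          (∀ ρ ∈ torsionFixing (W.baseChange K) ((2 ^ Mlev : ℕ) : ℤ), h1Eval (W.baseChange K) ((2 ^ Mlev : ℕ) : ℤ) z ρ = 0) →
          (∀ w : HeightOneSpectrum (𝓞 K), ((2 * W.conductorNorm ℤ : ℕ) : 𝓞 K) ∈ w.asIdeal →
            z ∈ selmerLocalKer (W.baseChange K) (w.adicCompletion K) ((2 ^ Mlev : ℕ) : ℤ)) → z = 0) :=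
  -- g27 pen: DISCHARGED BY NAME — gk2-p4 g31's tree theorem, statement VERBATIM (p780467 (module …Lw2PhantomExclusionKLW))
  Summit.BirchSwinnertonDyer.BirchSwinnertonDyer.Theorems.GenusExact.Lw2PhantomExclusion.nonPhantom_baseChange_of_levelTwoWitness

/-- STUB (S/M — re-thread a LANDED proof): `EquivariantKolyvaginExactAtTwoRT` (proved: `…Theorems.equivariantKolyvaginExactAtTwoRT_proof`)
with its three binders `∀ v, 2 ∉ v → N ∈ v → W.HasMultiplicativeReductionAt v →` replaced by the hypothesis `(NPh at 2N)(W, K)` (inline)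
(inserted after the frame's `¬ IsSquare` clauses).  The landed proof consumes `v` only through
`NonPhantomPow.nonPhantomAtTwo_of_hasMultiplicativeReductionAt`, whose conclusion IS `(NPh at 2N)(W, K)`. -/
theorem stub_Q3flat :
  KolyvaginRelationAtTwo → EquivariantChebotarevAtTwoR → (∀ (W : WeierstrassCurve ℚ) [W.IsElliptic], W.Δ < 0 → ∀ (c₀ : Field.absoluteGaloisGroup ℚ), Literature.NumberTheory.GaloisRepresentations.IsComplexConjugation (Rat.castHom ℝ) c₀ → ∀ (M : ℕ), ∃ P : W.geomTorsion ((2 ^ M : ℕ) : ℤ), ∀ Q : W.geomTorsion ((2 ^ M : ℕ) : ℤ), ∃ a b : ℤ, Q = a • P + b • (c₀ • P)) → ∀ (W : WeierstrassCurve ℚ) [W.IsElliptic] [W.IsGloballyMinimal] [NeZero (W.conductorNorm ℤ)], ¬ W.HasCM → Odd W.tamagawaProduct → W.Δ < 0 → ∀ (K : Type) [Field K] [NumberField K], Literature.NumberTheory.EllipticCurves.IsImaginaryQuadratic K → Odd (NumberField.discr K) → NumberField.discr K ≠ -3 → Literature.NumberTheory.EllipticCurves.SatisfiesHeegnerHypothesis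 (W.conductorNorm ℤ) K → ¬ IsSquare ((NumberField.discr K : ℚ) * -|W.Δ|) → ¬ IsSquare ((NumberField.discr K : ℚ) * (-(2 * |W.Δ|))) →
    (∀ (Mlev : ℕ), 1 ≤ Mlev → ∀ z : galH1Torsion (W.baseChange K) ((2 ^ Mlev : ℕ) : ℤ),
          (∀ ρ ∈ torsionFixing (W.baseChange K) ((2 ^ Mlev : ℕ) : ℤ), h1Eval (W.baseChange K) ((2 ^ Mlev : ℕ) : ℤ) z ρ = 0) →
          (∀ w : HeightOneSpectrum (𝓞 K), ((2 * W.conductorNorm ℤ : ℕ) : 𝓞 K) ∈ w.asIdeal →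
            z ∈ selmerLocalKer (W.baseChange K) (w.adicCompletion K) ((2 ^ Mlev : ℕ) : ℤ)) → z = 0) → (∀ n : ℕ, 0 < n → W.HasSurjectiveModNGaloisRep ((2 : ℤ) ^ n)) → ∀ (Dt : Literature.NumberTheory.EllipticCurves.ModularForms.ModularParametrizationData W (W.conductorNorm ℤ)) (β : ℤ) (ι : K →+* ℂ) (d₁ : Literature.NumberTheory.EllipticCurves.KolyvaginHeegnerData Dt β ι 1), ¬ IsOfFinAddOrder d₁.derivedPoint → ∀ (M₀ : ℕ), (∃ Q : (W.baseChange (Literature.NumberTheory.EllipticCurves.ringClassField K ι 1)).toAffine.Point, ((2 ^ M₀ : ℕ) : ℤ) • Q = d₁.derivedPoint) → (¬ ∃ Q : (W.baseChange (Literature.NumberTheory.EllipticCurves.ringClassField K ι 1)).toAffine.Point, ((2 ^ (M₀ + 1) : ℕ) : ℤ) • Q = d₁.derivedPoint) → W.rootNumber = 1 → ∀ (Wd : WeierstrassCurve ℚ) [Wd.IsElliptic] [Wd.IsGloballyMinimal], (∃ C : WeierstrassCurve.VariableChange ℚ, C • W.quadraticTwist (NumberField.discr K : ℚ) = Wd)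 → Nat.card (Wd.selmerGroup 2) = 2 → padicValNat 2 Wd.tamagawaProduct ≤ 1 → ∀ (n : ℕ) (d : Literature.NumberTheory.EllipticCurves.KolyvaginHeegnerData Dt β ι n), Squarefree n → (∀ ℓ ∈ n.primeFactors, Literature.NumberTheory.EllipticCurves.Zhang2014.IsKolyvaginPrime (W.conductorNorm ℤ) W K 2 ℓ ∧ 2 ≤ Literature.NumberTheory.EllipticCurves.Zhang2014.kolyvaginIndex W 2 ℓ ∧ Literature.NumberTheory.EllipticCurves.FrobEqFrobInfty W K 2 ℓ) → (¬ ∃ Q : (W.baseChange (Literature.NumberTheory.EllipticCurves.ringClassField K ι n)).toAffine.Point, (2 : ℤ) • Q = d.derivedPoint) → Nat.card (AddCommGroup.primaryComponent (W.baseChange K).sha 2) = 2 ^ (2 * M₀) := by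
  sorry

/-- STUB (S/M — re-thread a LANDED proof): `KolyvaginExactAtTwoPosDiscT` (proved: `…Theorems.kolyvaginExactAtTwoPosDiscT_proof`) with
the same surgery (`v`-binders out, `(NPh at 2N)(W, K)` in). -/
theorem stub_Q4flat :
  KolyvaginRelationAtTwo → ∀ (W : WeierstrassCurve ℚ) [W.IsElliptic] [W.IsGloballyMinimal] [NeZero (W.conductorNorm ℤ)], ¬ W.HasCM → Odd W.tamagawaProduct → 0 < W.Δ → ∀ (K : Type) [Field K] [NumberField K], Literature.NumberTheory.EllipticCurves.IsImaginaryQuadratic K → Odd (NumberField.discr K) → NumberField.discr K ≠ -3 → Literature.NumberTheory.EllipticCurves.SatisfiesHeegnerHypothesis (W.conductorNorm ℤ) K → ¬ IsSquare ((NumberField.discr K : ℚ) * -|W.Δ|) → ¬ IsSquare ((NumberField.discr K : ℚ) * (-(2 * |W.Δ|))) →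
    (∀ (Mlev : ℕ), 1 ≤ Mlev → ∀ z : galH1Torsion (W.baseChange K) ((2 ^ Mlev : ℕ) : ℤ),
          (∀ ρ ∈ torsionFixing (W.baseChange K) ((2 ^ Mlev : ℕ) : ℤ), h1Eval (W.baseChange K) ((2 ^ Mlev : ℕ) : ℤ) z ρ = 0) →
          (∀ w : HeightOneSpectrum (𝓞 K), ((2 * W.conductorNorm ℤ : ℕ) : 𝓞 K) ∈ w.asIdeal →
            z ∈ selmerLocalKer (W.baseChange K) (w.adicCompletion K) ((2 ^ Mlev : ℕ) : ℤ)) → z = 0) → (∀ n : ℕ, 0 < n → W.HasSurjectiveModNGaloisRep ((2 : ℤ) ^ n)) → ∀ (Dt : Literature.NumberTheory.EllipticCurves.ModularForms.ModularParametrizationData W (W.conductorNorm ℤ)) (β : ℤ) (ι : K →+* ℂ) (d₁ : Literature.NumberTheory.EllipticCurves.KolyvaginHeegnerData Dt β ι 1), ¬ IsOfFinAddOrder d₁.derivedPoint → ∀ (M₀ : ℕ), (∃ Q : (W.baseChange (Literature.NumberTheory.EllipticCurves.ringClassField K ι 1)).toAffine.Point, ((2 ^ M₀ : ℕ) : ℤ)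 • Q = d₁.derivedPoint) → (¬ ∃ Q : (W.baseChange (Literature.NumberTheory.EllipticCurves.ringClassField K ι 1)).toAffine.Point, ((2 ^ (M₀ + 1) : ℕ) : ℤ) • Q = d₁.derivedPoint) → W.rootNumber = 1 → ∀ (Wd : WeierstrassCurve ℚ) [Wd.IsElliptic] [Wd.IsGloballyMinimal], (∃ C : WeierstrassCurve.VariableChange ℚ, C • W.quadraticTwist (NumberField.discr K : ℚ) = Wd) → Nat.card (Wd.selmerGroup 2) = 2 → padicValNat 2 Wd.tamagawaProduct = 0 → ∀ (n : ℕ) (d : Literature.NumberTheory.EllipticCurves.KolyvaginHeegnerData Dt β ι n), Squarefree n → (∀ ℓ ∈ n.primeFactors, Literature.NumberTheory.EllipticCurves.Zhang2014.IsKolyvaginPrime (W.conductorNorm ℤ) W K 2 ℓ ∧ 2 ≤ Literature.NumberTheory.EllipticCurves.Zhang2014.kolyvaginIndex W 2 ℓ ∧ ∃ (v : IsDedekindDomain.HeightOneSpectrum (NumberField.RingOfIntegers ℚ)) (𝔓 : Ideal (Literature.NumberTheory.GaloisRepresentations.absIntegers (NumberField.RingOfIntegers ℚ) ℚ)) (h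 : Field.absoluteGaloisGroup ℚ), ((ℓ : ℕ) : NumberField.RingOfIntegers ℚ) ∈ v.asIdeal ∧ 𝔓 ∈ v.primesAbove ∧ IsArithFrobAt (NumberField.RingOfIntegers ℚ) h 𝔓 ∧ ∃ u : W.geomTorsion ((2 : ℕ) : ℤ), h • u ≠ u) → (¬ ∃ Q : (W.baseChange (Literature.NumberTheory.EllipticCurves.ringClassField K ι n)).toAffine.Point, (2 : ℤ) • Q = d.derivedPoint) → Nat.card (AddCommGroup.primaryComponent (W.baseChange K).sha 2) = 2 ^ (2 * M₀) := by
  sorry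

/-- STUB (the NEW RESIDUAL, honest — K₃/K-supply-class cells stay named): `OffCutResidualAtTwoR` with its first slice shrunk to
`… ∧ #Sel₂(E) ≠ 1 ∧ ¬ LW2 W` (instrument: 58 → 34 cells below `5·10⁵`: 18 good at 2, 16 additive at 2 without witness); slices 2
and 3 (supply off: `Δ < 0 ∧ #Sel₂ ∉ {1,4}`, `Δ > 0 ∧ ¬real-narrow`) verbatim. -/
theorem stub_residual :
  ∀ (W : WeierstrassCurve ℚ) [W.IsElliptic] [W.IsGloballyMinimal] [NeZero (W.conductorNorm ℤ)], ¬ W.HasCM → W.analyticRank = 0 → (∀ n : ℕ, 0 < n → W.HasSurjectiveModNGaloisRep ((2 : ℤ) ^ n)) → Odd W.tamagawaProduct → (∃ Dt : Literature.NumberTheory.EllipticCurves.ModularForms.ModularParametrizationData W (W.conductorNorm ℤ), (∀ z ∈ Dt.L.lattice, ∃ w ∈ Literature.NumberTheory.EllipticCurves.ModularForms.periodLattice Dt.f, z = (Dt.c : ℂ) * w) ∧ Odd Dt.c) → ((¬ (∃ v : IsDedekindDomain.HeightOneSpectrum (NumberField.RingOfIntegers ℚ), ((2 : ℕ) : NumberField.RingOfIntegers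 ℚ) ∉ v.asIdeal ∧ ((W.conductorNorm ℤ : ℕ) : NumberField.RingOfIntegers ℚ) ∈ v.asIdeal ∧ W.HasMultiplicativeReductionAt v)) ∧ Nat.card (W.selmerGroup 2) ≠ 1 ∧
 ¬ (∃ v : HeightOneSpectrum (𝓞 ℚ), ((W.conductorNorm ℤ : ℕ) : 𝓞 ℚ) ∈ v.asIdeal ∧
          (∀ z : galH1Torsion W 2, z ≠ 0 → (∀ ρ ∈ torsionFixing W 4, h1Eval W 2 z ρ = 0) →
            z ∉ selmerLocalKer W (v.adicCompletion ℚ) 2))) ∨ (W.Δ < 0 ∧ ¬ (Nat.card (W.selmerGroup 2) = 1 ∨ Nat.card (W.selmerGroup 2) = 4)) ∨ (0 < W.Δ ∧ ¬ (Nat.card (W.selmerGroup 2) = 1 ∨ (Nat.card (W.selmerGroup 2) = 4 ∧ ∃ c ∈ (W.kummerSelmerStructure ((2 : ℕ) : ℤ)).selmerGroup, Literature.NumberTheory.GaloisRepresentations.galoisCohomology.localization (W.torsionGaloisModule ((2 : ℕ) : ℤ)) (Sum.inl Rat.infinitePlace) 1 c ≠ 0))) → Literature.NumberTheory.EllipticCurves.BSDp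 W 2 := by
  sorry

/-- **COMPOSITION (kernel-checked, no sorry outside the stubs): the five stubs and the route's served items prove the crux
`OffCutResidualAtTwoR` BY NAME.**  The two engine branches are `closes` (rev 57) with the multiplicative place replaced by the
level-2 witness. -/
theorem OffCutResidualAtTwoR_of (hP : GenusPrimitiveSupplyAtTwoPosDiscShallow) (hPG : GenusDeepSupplyAtTwoNegDiscNarrow)
    (hQ1 : CyclicTorsionOfNegDisc) (hQ2 : KolyvaginRelationAtTwo) (hQ5R : EquivariantChebotarevAtTwoR)
    (hGf : ExactDescentAtTwoOfFourFacts) (hTw : MinimalTwinBSDTwo) (hL : EntireLFunctionRat) (hGZ : GrossZagierAllLevels)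
    (hGZK : MultPublishedInputsAtTwo) (hMi : MilneAnyModel) :
    OffCutResidualAtTwoR := by
  have hG : ExactDescentAtTwo := hGf ⟨hGZ, hGZK, hL, hMi⟩
  intro W _ _ _ hcm hr0 hρ hT hopt hslice
  by_cases hLW : (∃ v : HeightOneSpectrum (𝓞 ℚ), ((W.conductorNorm ℤ : ℕ) : 𝓞 ℚ) ∈ v.asIdeal ∧
      (∀ z : galH1Torsion W 2, z ≠ 0 → (∀ ρ ∈ torsionFixing W 4, h1Eval W 2 z ρ = 0) →
        z ∉ selmerLocalKer W (v.adicCompletion ℚ) 2))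
  swap
  · refine stub_residual W hcm hr0 hρ hT hopt ?_
    rcases hslice with ⟨hmult, h1⟩ | h23
    · exact Or.inl ⟨hmult, h1, hLW⟩
    · exact Or.inr h23
  rcases hslice with ⟨hmult, h1⟩ | h23
  swap
  · refine stub_residual W hcm hr0 hρ hT hopt (Or.inr h23)
  -- slice 1 with a level-2 witness: the engine of `closes`, the witness in place of the multiplicative prime
  have hw : ∀ Dt : ModularParametrizationData W (W.conductorNorm ℤ), W.rootNumber = 1 := fun Dt ↦
    (Literature.Barriers.BirchSwinnertonDyer.even_analyticRank_iff_of_isNewformOf_conductorLevel Dt.isNewformOf).mp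
      (by rw [hr0]; exact Even.zero)
  rcases lt_or_gt_of_ne W.isUnit_Δ.ne_zero with hneg | hpos
  · by_cases h14 : Nat.card (W.selmerGroup 2) = 1 ∨ Nat.card (W.selmerGroup 2) = 4
    · obtain ⟨K, _, _, hIQ, hodd, h3, hHe, hsq1, hsq2, Dt, β, ι, d₁, hoptDt, hc, hy, M₀, hdiv, hndiv,
        n, d, hn, hKoly, hPn, Wd, _, _, hWd, hcmd, hrd, hSel, hDEF⟩ := hPG W hcm hr0 hρ hT hneg hopt h14
      obtain ⟨w₀, h2Nw, hLWK⟩ := transport_byName W hT hρ K hIQ hodd hHe hsq1 hsq2 hLW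
      have hNPh := klw_byName W hT hρ K hIQ hodd hHe hsq1 hsq2 w₀ h2Nw hLWK
      have hBd : BSDp Wd 2 := hTw Wd hcmd hrd hSel
      exact hG W hcm hr0 hρ hT K hIQ hodd h3 hHe Dt hoptDt hc β ι d₁ hy M₀ hdiv hndiv
        (stub_Q3flat hQ2 hQ5R hQ1 W hcm hT hneg K hIQ hodd h3 hHe hsq1 hsq2 hNPh hρ Dt β ι d₁ hy M₀ hdiv hndiv
          (hw Dt) Wd hWd hSel hDEF n d hn hKoly hPn)
        Wd hWd hSel hBd
    · exact stub_residual W hcm hr0 hρ hT hopt (Or.inr (Or.inl ⟨hneg, h14⟩))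
  · by_cases h14 : Nat.card (W.selmerGroup 2) = 1 ∨ (Nat.card (W.selmerGroup 2) = 4 ∧
        ∃ c ∈ (W.kummerSelmerStructure ((2 : ℕ) : ℤ)).selmerGroup,
          Literature.NumberTheory.GaloisRepresentations.galoisCohomology.localization (W.torsionGaloisModule ((2 : ℕ) : ℤ))
            (Sum.inl Rat.infinitePlace) 1 c ≠ 0)
    · obtain ⟨K, _, _, hIQ, hodd, h3, hHe, hsq1, hsq2, Dt, β, ι, d₁, hoptDt, hc, hy, M₀, hdiv, hndiv,
        n, d, hn, hKoly, hPn, Wd, _, _, hWd, hcmd, hrd, hSel, hTam⟩ := hP W hcm hr0 hρ hT hpos hopt h14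
      obtain ⟨w₀, h2Nw, hLWK⟩ := transport_byName W hT hρ K hIQ hodd hHe hsq1 hsq2 hLW
      have hNPh := klw_byName W hT hρ K hIQ hodd hHe hsq1 hsq2 w₀ h2Nw hLWK
      have hBd : BSDp Wd 2 := hTw Wd hcmd hrd hSel
      exact hG W hcm hr0 hρ hT K hIQ hodd h3 hHe Dt hoptDt hc β ι d₁ hy M₀ hdiv hndiv
        (stub_Q4flat hQ2 W hcm hT hpos K hIQ hodd h3 hHe hsq1 hsq2 hNPh hρ Dt β ι d₁ hy M₀ hdiv hndiv (hw Dt) Wd hWd hSel hTam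
          n d hn hKoly hPn)
        Wd hWd hSel hBd
    · exact stub_residual W hcm hr0 hρ hT hopt (Or.inr (Or.inr ⟨hpos, h14⟩))

end Summit.BirchSwinnertonDyer.BirchSwinnertonDyer.Cruxes.OffCutResidualAtTwoR.Lw2PhantomExclusion
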